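import Literature.NumberTheory.Automorphic.UnitaryGroupPureTensorContinuity
import Literature.NumberTheory.Automorphic.LocalHermitianFormsRankThree
import Literature.NumberTheory.Automorphic.LocalUnitaryGroupCongr
import Literature.NumberTheory.Automorphic.UnitaryGroupArchTopology
import Mathlib.Topology.UrysohnsLemma
import HarnessLib

/-!
# Global transfer of test functions AWAY from the bad places: `GlobalTransferAway ψ S₀ f′ f`, its non-vacuity, and the
# supply of level-matching local identifications `ψ_v : U(H)(L⁺_v) ≃ₜ* U(Φ₃)(L⁺_v)` for an inner form of `U(3)`
(Rogawski, *Automorphic representations of unitary groups in three variables* (1990), §14.2 p. 233)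

Topic `NumberTheory/Automorphic`; namespace `Literature.NumberTheory.Automorphic.UnitaryGroup`.  ONE definition with body
(`GlobalTransferAway`, a RELATION between test functions on two forms — nothing is asserted) and proved theorems; no named fact,
no `sorry`, no instance, no notation.

**Setting.** `L` a CM field (`F = L⁺`, `c` = complex conjugation), `H, H′ ∈ M_N(L)`, the adelic data ★ `UnitaryGroup.cmDatum L N H`,
local identifications `ψ_v : U(H)(L⁺_v) ≃ₜ* U(H′)(L⁺_v)` at every finite place, pure tensors ★ `UnitaryGroup.PureTensor`
(`Rogawski1990/TestFunctions`: `f = f_∞ ⊗ ⊗_v f_v`, `f_v = 1_{K_v}` off the bad set `S`), the place-wise relation ★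
`LocalTransferAway ψ T T′ S₀bad` («`f′_v = f_v ∘ ψ_v⁻¹` for `v ∉ S₀bad`»), the integral levels ★ `cmLocalIntegralLevel L N H v` (B9) and
★ `PureTensor.toCc` (B10-lite).

* §1 **(D) `GlobalTransferAway ψ S₀ f′ f`** for `f′ ∈ C_c(U(H)(𝔸))`, `f ∈ C_c(U(H′)(𝔸))`: `f′`, `f` are pure tensors `T`, `T′` whose local
  factors MATCH along `ψ_v` at every `v ∉ S₀ ∪ S ∪ S′` — [Rogawski1990, §14.2 p. 233]: «for `v ∉ S₀ ∪ S` … we identify `G′_v` and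
  `G_v` … `f_v = f′_v`».  Nothing is asserted at `S₀ ∪ S ∪ S′` or at infinity (the transfer-factor layer §4.9–4.13, §14.2–3 is
  elsewhere): this is an honest OVER-approximation of Rogawski's transfer `f′ → f`, exact away from the bad places.
* §2 **(N) non-vacuity** `exists_globalTransferAway_ne_zero`: if the `ψ_v` match the integral levels off `S₀`
  (`ψ_v g ∈ U(H′)(𝒪_v) ↔ g ∈ U(H)(𝒪_v)`), there are `f′ ≠ 0` and `f` with `GlobalTransferAway ψ S₀ f′ f` — the UNIT tensors
  `1_{K_∞-bump} ⊗ ⊗_v 1_{U(𝒪_v)}` on both sides (Urysohn bump with `f_∞(1) = 1` on the locally compact archimedean group, ★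
  `instLocallyCompactSpaceArch`; `PureTensor.toCc`).
* §3 **(Ψ) the supply for `N = 3`** `exists_psi_forall_levelMatching`: for an ANISOTROPIC hermitian `H ∈ M₃(L)` there are
  `ψ_v : U(H)(L⁺_v) ≃ₜ* U(Φ₃)(L⁺_v)` at EVERY finite `v` and a finite `S₀` such that `ψ_v` matches the integral levels for all `v ∉ S₀`
  (everywhere: ★ `nonempty_cmDatum_local_equiv_antidiag_of_forall_nonsplit_formCongr` + ★ `exists_isUnit_formCongr_map_eq_smul_antidiag_of_smul_eq`
  (B3 + B4); off `S₀`: ★ `eventually_exists_continuousMulEquiv_cmLocalIntegralLevel_iff_of_anisotropic` (B9); glued place by place).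

Written for the cell `hodgecm-mathlib` (ENGINE T1, line `F0_T1InnerFormTraceIdentity`, brick B11: the object through which the line pins
the kit's `Transfer` away from `S₀ ∪ S`).  HC_CM is proved only modulo the printed citations until rung 0 closes; this file is unconditional.

## References
* [Rogawski1990] J. Rogawski, Ann. of Math. Stud. 123 (1990), §14.2 p. 233.
* [BorelJacquet1979] A. Borel, H. Jacquet, PSPM 33.1 (1979), §4.1 (factorizable functions on `G(𝔸)`).
-/

set_option autoImplicit false

noncomputable section

open NumberField IsDedekindDomain Filter Set
open Literature.AlgebraicGeometry.ShimuraVarieties (hermForm)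
open scoped Classical

namespace Literature.NumberTheory.Automorphic.UnitaryGroup

variable (L : Type) [Field L] [NumberField L] [IsCMField L] (N : ℕ)

/-! ## §1 (D) Global transfer away from the bad places -/

/-- **`GlobalTransferAway ψ S₀ f′ f` — `f′ ∈ C_c(U(H)(𝔸_{L⁺}))` and `f ∈ C_c(U(H′)(𝔸_{L⁺}))` are pure tensors matching along the
local identifications `ψ_v` away from `S₀` and their own bad sets**: `∃ T T′` pure tensors with `f′ = T.eval`, `f = T′.eval` and
`LocalTransferAway ψ T T′ (S₀ ∪ T.S ∪ T′.S)` (★ `Rogawski1990/TestFunctions`), i.e. `T′.loc v = T.loc v ∘ ψ_v⁻¹` for every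
`v ∉ S₀ ∪ S ∪ S′` — [Rogawski1990, §14.2 p. 233]: «for `v ∉ S₀ ∪ S` … `f_v = f′_v`».  A RELATION; nothing at the bad places or at
infinity. [cite: Rogawski1990, §14.2 p. 233] -/
def GlobalTransferAway {H H' : Matrix (Fin N) (Fin N) L}
    (ψ : ∀ v : HeightOneSpectrum (𝓞 ↥(maximalRealSubfield L)), (cmDatum L N H).Local v ≃ₜ* (cmDatum L N H').Local v)
    (S₀ : Finset (HeightOneSpectrum (𝓞 ↥(maximalRealSubfield L))))
    (f' : CompactlySupportedContinuousMap (cmDatum L N H).Adelic ℂ)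
    (f : CompactlySupportedContinuousMap (cmDatum L N H').Adelic ℂ) : Prop :=
  ∃ (T : PureTensor L N H) (T' : PureTensor L N H'), ⇑f' = T.eval ∧ ⇑f = T'.eval ∧
    LocalTransferAway L N ψ T T' (S₀ ∪ T.S ∪ T'.S)

/-- Unfolding of `GlobalTransferAway`. [cite: Rogawski1990, §14.2 p. 233] -/
theorem globalTransferAway_iff {H H' : Matrix (Fin N) (Fin N) L}
    (ψ : ∀ v : HeightOneSpectrum (𝓞 ↥(maximalRealSubfield L)), (cmDatum L N H).Local v ≃ₜ* (cmDatum L N H').Local v)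
    (S₀ : Finset (HeightOneSpectrum (𝓞 ↥(maximalRealSubfield L))))
    (f' : CompactlySupportedContinuousMap (cmDatum L N H).Adelic ℂ)
    (f : CompactlySupportedContinuousMap (cmDatum L N H').Adelic ℂ) :
    GlobalTransferAway L N ψ S₀ f' f ↔
      ∃ (T : PureTensor L N H) (T' : PureTensor L N H'), ⇑f' = T.eval ∧ ⇑f = T'.eval ∧
        ∀ v ∉ S₀ ∪ T.S ∪ T'.S, T'.loc v = T.loc v ∘ (ψ v).symm :=
  Iff.rfl

/-! ## §2 (N) Non-vacuity: the unit tensors match along level-matching `ψ` -/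

variable {N} in
/-- **The unit pure tensor** `f_∞ ⊗ ⊗_v 1_{U(H)(𝒪_v)}` with a prescribed archimedean factor: no bad places (`S = ∅`), unramified levels
`K_v = U(H)(𝒪_v)` (★ `cmLocalIntegralLevel`) and `f_v = 1_{K_v}` at EVERY finite `v`. [cite: Rogawski1990, §14.2 p. 233] -/
def PureTensor.unit (H : Matrix (Fin N) (Fin N) L)
    (a : UnitaryGroup.arch (↥(maximalRealSubfield L)) L (IsCMField.complexConj L) N H → ℂ) : PureTensor L N H where
  S := ∅
  K := fun v => cmLocalIntegralLevel L N H v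
  loc := fun v => ((cmLocalIntegralLevel L N H v : Set ((cmDatum L N H).Local v))).indicator fun _ => 1
  arch := a
  loc_eq_indicator := fun _ _ => rfl

variable {N} in
/-- The unit tensor at the identity: `(f_∞ ⊗ ⊗_v 1_{K_v})(1) = f_∞(1)`. [cite: Rogawski1990, §14.2 p. 233] -/
theorem PureTensor.unit_eval_one (H : Matrix (Fin N) (Fin N) L)
    (a : UnitaryGroup.arch (↥(maximalRealSubfield L)) L (IsCMField.complexConj L) N H → ℂ) :
    (PureTensor.unit L H a).eval 1 = a 1 := by
  rw [PureTensor.eval_eq_of_forall_mem (PureTensor.unit L H a) 1 fun v _ => by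
    rw [map_one]; exact Subgroup.one_mem _]
  change a (archPart (↥(maximalRealSubfield L)) L (IsCMField.complexConj L) N H 1) * ∏ v ∈ (∅ : Finset _), _ = a 1
  rw [map_one, Finset.prod_empty, mul_one]

variable {N} in
/-- On the (locally compact, Hausdorff) archimedean group `U(H)(L⁺ ⊗ ℝ)` there is a continuous compactly supported real bump `φ`
with `φ(1) = 1` (Urysohn, Mathlib `exists_continuous_one_zero_of_isCompact`; ★ `instLocallyCompactSpaceArch`). [cite: BorelJacquet1979, §4.1] -/
theorem exists_arch_bump (H : Matrix (Fin N) (Fin N) L) :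
    ∃ φ : arch (↥(maximalRealSubfield L)) L (IsCMField.complexConj L) N H → ℝ,
      Continuous φ ∧ HasCompactSupport φ ∧ φ 1 = 1 := by
  obtain ⟨φ, hφ1, -, hφc, -⟩ := exists_continuous_one_zero_of_isCompact
    (X := arch (↥(maximalRealSubfield L)) L (IsCMField.complexConj L) N H)
    (isCompact_singleton (x := (1 : arch (↥(maximalRealSubfield L)) L (IsCMField.complexConj L) N H)))
    isClosed_empty (Set.disjoint_empty _)
  exact ⟨φ, φ.continuous, hφc, hφ1 (Set.mem_singleton _)⟩

/-- **(N) Non-vacuity of `GlobalTransferAway`.**  If the local identifications `ψ_v` match the integral levels away from `S₀`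
(`ψ_v g ∈ U(H′)(𝒪_v) ↔ g ∈ U(H)(𝒪_v)` for `v ∉ S₀`), then some `f′ ≠ 0` in `C_c(U(H)(𝔸))` is transferred: the unit tensors
`φ_∞ ⊗ ⊗_v 1_{U(H)(𝒪_v)}` and `φ′_∞ ⊗ ⊗_v 1_{U(H′)(𝒪_v)}` (archimedean Urysohn bumps with `φ(1) = 1`) satisfy
`1_{U(H′)(𝒪_v)} = 1_{U(H)(𝒪_v)} ∘ ψ_v⁻¹` off `S₀`, and `f′(1) = 1`. [cite: Rogawski1990, §14.2 p. 233] -/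
theorem exists_globalTransferAway_ne_zero {H H' : Matrix (Fin N) (Fin N) L}
    (ψ : ∀ v : HeightOneSpectrum (𝓞 ↥(maximalRealSubfield L)), (cmDatum L N H).Local v ≃ₜ* (cmDatum L N H').Local v)
    (S₀ : Finset (HeightOneSpectrum (𝓞 ↥(maximalRealSubfield L))))
    (hψ : ∀ v ∉ S₀, ∀ g, ψ v g ∈ cmLocalIntegralLevel L N H' v ↔ g ∈ cmLocalIntegralLevel L N H v) :
    ∃ (f' : CompactlySupportedContinuousMap (cmDatum L N H).Adelic ℂ)
      (f : CompactlySupportedContinuousMap (cmDatum L N H').Adelic ℂ), f' ≠ 0 ∧ GlobalTransferAway L N ψ S₀ f' f := by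
  classical
  obtain ⟨φ, hφ, hφc, hφ1⟩ := exists_arch_bump L H
  obtain ⟨φ', hφ', hφ'c, -⟩ := exists_arch_bump L H'
  let T : PureTensor L N H := PureTensor.unit L H fun g => (φ g : ℂ)
  let T' : PureTensor L N H' := PureTensor.unit L H' fun g => (φ' g : ℂ)
  have hK : ∀ v ∉ T.S, T.K v = cmLocalIntegralLevel L N H v := fun _ _ => rfl
  have hK' : ∀ v ∉ T'.S, T'.K v = cmLocalIntegralLevel L N H' v := fun _ _ => rfl
  have ha : Continuous T.arch := Complex.continuous_ofReal.comp hφ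
  have ha' : Continuous T'.arch := Complex.continuous_ofReal.comp hφ'
  have hac : HasCompactSupport T.arch := hφc.comp_left Complex.ofReal_zero
  have hac' : HasCompactSupport T'.arch := hφ'c.comp_left Complex.ofReal_zero
  have hl : ∀ v ∈ T.S, Continuous (T.loc v) := fun v hv => absurd hv (Finset.notMem_empty v)
  have hl' : ∀ v ∈ T'.S, Continuous (T'.loc v) := fun v hv => absurd hv (Finset.notMem_empty v)
  have hlc : ∀ v ∈ T.S, HasCompactSupport (T.loc v) := fun v hv => absurd hv (Finset.notMem_empty v)
  have hlc' : ∀ v ∈ T'.S, HasCompactSupport (T'.loc v) := fun v hv => absurd hv (Finset.notMem_empty v)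
  refine ⟨T.toCc hK ha hac hl hlc, T'.toCc hK' ha' hac' hl' hlc', fun h0 => ?_, T, T', rfl, rfl, fun v hv => ?_⟩
  · -- `f′(1) = φ(1) = 1 ≠ 0`
    have h1 : T.eval 1 = 1 := by
      rw [show T = PureTensor.unit L H fun g => (φ g : ℂ) from rfl, PureTensor.unit_eval_one, hφ1, Complex.ofReal_one]
    have h := DFunLike.congr_fun h0 (1 : (cmDatum L N H).Adelic)
    rw [PureTensor.toCc_apply, CompactlySupportedContinuousMap.zero_apply, h1] at h
    exact one_ne_zero h
  · -- the matching `1_{U(H′)(𝒪_v)} = 1_{U(H)(𝒪_v)} ∘ ψ_v⁻¹` for `v ∉ S₀`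
    have hv₀ : v ∉ S₀ := by
      simp only [Finset.union_empty, show T.S = ∅ from rfl, show T'.S = ∅ from rfl] at hv
      exact hv
    funext k'
    change ((cmLocalIntegralLevel L N H' v : Set ((cmDatum L N H').Local v))).indicator (fun _ => (1 : ℂ)) k' =
      ((cmLocalIntegralLevel L N H v : Set ((cmDatum L N H).Local v))).indicator (fun _ => (1 : ℂ)) ((ψ v).symm k')
    by_cases hk : k' ∈ cmLocalIntegralLevel L N H' v
    · have hk' : (ψ v).symm k' ∈ cmLocalIntegralLevel L N H v :=
        (hψ v hv₀ _).1 (by rw [ContinuousMulEquiv.apply_symm_apply]; exact hk)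
      rw [Set.indicator_of_mem (show k' ∈ (cmLocalIntegralLevel L N H' v : Set _) from hk),
        Set.indicator_of_mem (show (ψ v).symm k' ∈ (cmLocalIntegralLevel L N H v : Set _) from hk')]
    · have hk' : (ψ v).symm k' ∉ cmLocalIntegralLevel L N H v := fun h =>
        hk (by have h' := (hψ v hv₀ _).2 h; rwa [ContinuousMulEquiv.apply_symm_apply] at h')
      rw [Set.indicator_of_notMem (show k' ∉ (cmLocalIntegralLevel L N H' v : Set _) from hk),
        Set.indicator_of_notMem (show (ψ v).symm k' ∉ (cmLocalIntegralLevel L N H v : Set _) from hk')]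

/-! ## §3 (Ψ) The supply of level-matching local identifications for an inner form of `U(3)` -/

/-- **(Ψ) For an ANISOTROPIC hermitian `H ∈ M₃(L)` there are local identifications `ψ_v : U(H)(L⁺_v) ≃ₜ* U(Φ₃)(L⁺_v)` at EVERY
finite place of `L⁺` and a finite set `S₀` off which `ψ_v` matches the integral levels** (`ψ_v g ∈ U(Φ₃)(𝒪_v) ↔ g ∈ U(H)(𝒪_v)`):
the everywhere-isomorphisms of [Rogawski1990, §14.2 p. 232 (i)–(iii)] (★ B3∕B4: `nonempty_cmDatum_local_equiv_antidiag_of_forall_nonsplit_formCongr`,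
`exists_isUnit_formCongr_map_eq_smul_antidiag_of_smul_eq`) and, off a finite set, the level-matching ones of [§14.2 p. 233] (★ B9:
`eventually_exists_continuousMulEquiv_cmLocalIntegralLevel_iff_of_anisotropic`), glued place by place. [cite: Rogawski1990, §14.2 p. 233] -/
theorem exists_psi_forall_levelMatching (H : Matrix (Fin 3) (Fin 3) L)
    (hanis : ∀ x : Fin 3 → L, hermForm (cmConjRingHom L) H x x = 0 → x = 0) (hherm : (H.map (cmConjRingHom L)).transpose = H) :
    ∃ (ψ : ∀ v : HeightOneSpectrum (𝓞 ↥(maximalRealSubfield L)), (cmDatum L 3 H).Local v ≃ₜ*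
        (cmDatum L 3 (Matrix.of fun i j : Fin 3 => if i.val + j.val + 1 = 3 then (1 : L) else 0)).Local v)
      (S₀ : Finset (HeightOneSpectrum (𝓞 ↥(maximalRealSubfield L)))),
      ∀ v ∉ S₀, ∀ g, ψ v g ∈ cmLocalIntegralLevel L 3 (Matrix.of fun i j : Fin 3 => if i.val + j.val + 1 = 3 then (1 : L) else 0) v ↔
        g ∈ cmLocalIntegralLevel L 3 H v := by
  classical
  have hall : ∀ v : HeightOneSpectrum (𝓞 ↥(maximalRealSubfield L)), Nonempty ((cmDatum L 3 H).Local v ≃ₜ*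
      (cmDatum L 3 (Matrix.of fun i j : Fin 3 => if i.val + j.val + 1 = 3 then (1 : L) else 0)).Local v) :=
    nonempty_cmDatum_local_equiv_antidiag_of_forall_nonsplit_formCongr L H hanis hherm fun v w hw =>
      exists_isUnit_formCongr_map_eq_smul_antidiag_of_smul_eq L (IsCMField.complexConj L) (IsCMField.complexConj_ne_one L) H
        hherm (Godement.det_ne_zero_of_anisotropic L H hanis) w hw
  have hev := eventually_exists_continuousMulEquiv_cmLocalIntegralLevel_iff_of_anisotropic L 3 H hanis hherm
  rw [Filter.eventually_cofinite] at hev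
  refine ⟨fun v => if h : ∃ ψ : (cmDatum L 3 H).Local v ≃ₜ*
        (cmDatum L 3 (Matrix.of fun i j : Fin 3 => if i.val + j.val + 1 = 3 then (1 : L) else 0)).Local v,
        ∀ g, ψ g ∈ cmLocalIntegralLevel L 3 (Matrix.of fun i j : Fin 3 => if i.val + j.val + 1 = 3 then (1 : L) else 0) v ↔
          g ∈ cmLocalIntegralLevel L 3 H v
      then h.choose else Classical.choice (hall v), hev.toFinset, fun v hv g => ?_⟩
  have h : ∃ ψ : (cmDatum L 3 H).Local v ≃ₜ*
      (cmDatum L 3 (Matrix.of fun i j : Fin 3 => if i.val + j.val + 1 = 3 then (1 : L) else 0)).Local v,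
      ∀ g, ψ g ∈ cmLocalIntegralLevel L 3 (Matrix.of fun i j : Fin 3 => if i.val + j.val + 1 = 3 then (1 : L) else 0) v ↔
        g ∈ cmLocalIntegralLevel L 3 H v := by
    rw [Set.Finite.mem_toFinset] at hv
    exact not_not.1 hv
  simp only [dif_pos h]
  exact h.choose_spec g

end Literature.NumberTheory.Automorphic.UnitaryGroup

end
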